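import Summits.CriticalPhenomena.SAWScalingLimit.Theorems.SAWDevelopingMapObservableToSLETypeLadderBandDefs
import Summits.CriticalPhenomena.SAWScalingLimit.Theorems.SAWDevelopingMapObservableToSLETypeLadderBandPrefixConditioning
import Summits.CriticalPhenomena.SAWScalingLimit.Theorems.SAWDevelopingMapObservableToSLETypeLadderBandSuccessDecided
import Literature.Probability.RandomPlanarGeometry.HexParafermionSpinShift
import HarnessLib

/-!
# The `m`-fold prefix-conditioning iteration (band iteration, piece I7a)

Crux `Summit.CriticalPhenomena.SAWScalingLimit.Theses.SAWDevelopingMap.ObservableToSLE`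
(item stmt-CriticalPhenomena-10472), line `six-class-type-ladder`, skeleton r16 (band-wise cut of the
abundance residue).  Self-registered stub `stub_bandIterate`, the probabilistic core of the one-end
band iteration `stub_oneEndBound`:

if `m` events `Fail 0, …, Fail (m-1)` of the vertex list of the critical hexagonal SAW from `u` to `b`
are such that, for every `k < m`, (i) every earlier event `Fail j`, `j < k`, is decided by the exit
prefix from the closed `rad k`-ball about the rescaled root `δ·u`, and (ii) `Fail k` has carved
probability `≤ c` after EVERY self-avoiding exit prefix from that ball, then
`P(⋂_{k<m} Fail k) ≤ c ^ m`.  This is the landed one-step inequality `stub_prefixConditioning`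
(piece I2: `P(F ∧ G) ≤ c · P(F)`) applied `m` times, with `F := ⋂_{j<k} Fail j`, `G := Fail k`, and
`P(univ) ≤ 1`.

Also here, for the consumer: `bandSuccess_decided_of_le` (band success, decided by the exit prefix
from the `P`-ball by the landed piece I4 `stub_bandSuccess_decided`, is decided by the exit prefix
from every larger ball), and the lattice-step bookkeeping `dist_le_of_hexDomainGraph_adj`,
`dist_tip_le_of_isPath` (the tip of an exit prefix from the closed `r`-ball is within `r + δ`).
Sources: H. Kesten, J. Math. Phys. 4 (1963) §4; N. Madras, G. Slade, *The Self-Avoiding Walk*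
(1993) §1.2 (domain Markov property).
-/

noncomputable section

open scoped BigOperators Topology NNReal ENNReal Classical
open Filter Set MeasureTheory Metric
open Literature.Probability.LatticeModels (HexVertex hexGraph hexCenter triZeta Site)
open Literature.Probability.RandomPlanarGeometry
open Literature.Probability.RandomPlanarGeometry.SAW

namespace Summit.CriticalPhenomena.SAWScalingLimit.Theorems.ObservableToSLE.TypeLadder

open Summit.CriticalPhenomena.SAWScalingLimit.Theorems.ObservableToSLER.BridgeGate
  (hexBall HasCleanWindow carvedLaw rowOf)
open Summit.CriticalPhenomena.SAWScalingLimit.Theorems.ObservableToSLER.NestedGate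

/-! ### Total mass of the critical law -/

/-- The critical SAW law has total mass at most one: it is `Z⁻¹ • W` with `Z = W univ`, and the
junk cases `Z = 0`, `Z = ∞` give mass `0`. [folklore] -/
theorem hexSAWLaw_univ_le_one (Ω : Set ℂ) (δ : ℝ) (a b : HexVertex) :
    hexSAWLaw Ω δ a b Set.univ ≤ 1 := by
  simp only [embLaw, Measure.smul_apply, smul_eq_mul]
  exact ENNReal.inv_mul_le_one _

/-! ### The iteration -/

/-- Self-registered stub `stub_bandIterate` (crux item stmt-CriticalPhenomena-10472, skeleton r16,
band iteration piece I7a): **the `m`-fold prefix-conditioning inequality.**  For events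
`Fail k` (`k < m`) of the vertex list of the critical SAW of `Ω_δ` from `u` to `b` and radii `rad k`
with `rad k < dist (δb) (δu)`: if every `Fail j`, `j < k`, is decided by the exit prefix from the
closed `rad k`-ball about `δ·u`, and `Fail k` has carved probability `≤ c` (`0 ≤ c`) after every
self-avoiding exit prefix `ω₀ : u → t` from that ball (non-tip vertices inside, tip outside), then
`hexSAWLaw Ω δ u b {∀ k < m, Fail k} ≤ ofReal (c ^ m)`.  Induction on `m` through
`stub_prefixConditioning` and `hexSAWLaw_univ_le_one`. -/
theorem stub_bandIterate :
    ∀ (Ω : Set ℂ) (δ c : ℝ) (u b : HexVertex) (m : ℕ) (rad : ℕ → ℝ)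
      (Fail : ℕ → List HexVertex → Prop), 0 ≤ c →
      (∀ k, k < m → rad k < dist ((δ : ℂ) * hexCenter b) ((δ : ℂ) * hexCenter u)) →
      (∀ j k : ℕ, j < k → k < m → ∀ (l : List HexVertex) (i : ℕ) (hi : i < l.length),
          (∀ (k' : ℕ) (hk' : k' < l.length), k' < i →
            dist ((δ : ℂ) * hexCenter (l[k']'hk')) ((δ : ℂ) * hexCenter u) ≤ rad k) →
          rad k < dist ((δ : ℂ) * hexCenter (l[i]'hi)) ((δ : ℂ) * hexCenter u) →
          (Fail j l ↔ Fail j (l.take (i + 1)))) →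
      (∀ k, k < m → ∀ (t : HexVertex) (ω₀ : (hexDomainGraph Ω δ).Walk u t), ω₀.IsPath →
          (∀ v ∈ ω₀.support, v ≠ t →
            dist ((δ : ℂ) * hexCenter v) ((δ : ℂ) * hexCenter u) ≤ rad k) →
          rad k < dist ((δ : ℂ) * hexCenter t) ((δ : ℂ) * hexCenter u) →
          carvedLaw Ω δ {v | v ∈ ω₀.support ∧ v ≠ t} t b
              {η | Fail k (ω₀.support ++ η.walk.support.tail)} ≤ ENNReal.ofReal c) →
      hexSAWLaw Ω δ u b {γ | ∀ k, k < m → Fail k γ.walk.support} ≤ ENNReal.ofReal (c ^ m) := by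
  intro Ω δ c u b m rad Fail hc hfar hdec hbnd
  rw [ENNReal.ofReal_pow hc]
  suffices h : ∀ n, n ≤ m →
      hexSAWLaw Ω δ u b {γ | ∀ k, k < n → Fail k γ.walk.support} ≤ ENNReal.ofReal c ^ n from
    h m le_rfl
  intro n
  induction n with
  | zero =>
    intro _
    rw [pow_zero]
    exact (measure_mono (Set.subset_univ _)).trans (hexSAWLaw_univ_le_one Ω δ u b)
  | succ n ih =>
    intro hn
    have hnm : n < m := hn
    -- `⋂_{k ≤ n} Fail k = (⋂_{k < n} Fail k) ∩ Fail n`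
    have hset : {γ : HexDomainSAW Ω δ u b | ∀ k, k < n + 1 → Fail k γ.walk.support} =
        {γ | (∀ k, k < n → Fail k γ.walk.support) ∧ Fail n γ.walk.support} := by
      ext γ
      simp only [Set.mem_setOf_eq]
      constructor
      · intro h
        exact ⟨fun k hk => h k (Nat.lt_succ_of_lt hk), h n n.lt_succ_self⟩
      · rintro ⟨h1, h2⟩ k hk
        rcases Nat.lt_or_ge k n with hk' | hk'
        · exact h1 k hk'
        · have hkn : k = n := by omega
          subst hkn
          exact h2
    -- one step of prefix conditioning at radius `rad n`
    have key := stub_prefixConditioning Ω δ (rad n) c ((δ : ℂ) * hexCenter u) u b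
      (fun l => ∀ k, k < n → Fail k l) (Fail n) hc (hfar n hnm)
      (fun l i hi hclose hfar' => forall₂_congr fun k hk => hdec k n hk hnm l i hi hclose hfar')
      (fun t ω₀ hπ _ hS ht => hbnd n hnm t ω₀ hπ hS ht)
    rw [hset]
    calc hexSAWLaw Ω δ u b
          {γ | (∀ k, k < n → Fail k γ.walk.support) ∧ Fail n γ.walk.support}
        ≤ ENNReal.ofReal c * hexSAWLaw Ω δ u b {γ | ∀ k, k < n → Fail k γ.walk.support} := key
      _ ≤ ENNReal.ofReal c * ENNReal.ofReal c ^ n := mul_le_mul_right (ih hnm.le) _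
      _ = ENNReal.ofReal c ^ (n + 1) := (pow_succ' _ _).symm

/-! ### Band success is decided by the exit prefix from every larger ball -/

/-- **Band success is decided by the exit prefix from every ball of radius `r ≥ P`.**  If every level
lies in the closed `ρout`-ball about the rescaled root, `ρout < P ≤ r`, and the entry `l[i]` is
farther than `r` from the rescaled root, then `BandSuccess … l ↔ BandSuccess … (l.take (i + 1))`:
apply the landed piece I4 `stub_bandSuccess_decided` at the FIRST `P`-far index `i₀ ≤ i`, both to
`l` and to `l.take (i + 1)` (same entries up to `i₀`), and note
`(l.take (i + 1)).take (i₀ + 1) = l.take (i₀ + 1)`. -/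
theorem bandSuccess_decided_of_le {Ω : Set ℂ} {δ ρ P ρout r : ℝ} {S : ℕ → Set HexVertex}
    {c : HexVertex}
    (hS : ∀ n, ∀ v ∈ S n, dist ((δ : ℂ) * hexCenter v) ((δ : ℂ) * hexCenter c) ≤ ρout)
    (hρ : ρout < P) (hPr : P ≤ r) (l : List HexVertex) (i : ℕ) (hi : i < l.length)
    (hfar : r < dist ((δ : ℂ) * hexCenter (l[i]'hi)) ((δ : ℂ) * hexCenter c)) :
    BandSuccess Ω δ ρ P S c l ↔ BandSuccess Ω δ ρ P S c (l.take (i + 1)) := by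
  -- the first `P`-far index `i₀ ≤ i`
  have hex : ∃ i₀, ∃ h : i₀ < l.length,
      P < dist ((δ : ℂ) * hexCenter (l[i₀]'h)) ((δ : ℂ) * hexCenter c) :=
    ⟨i, hi, hPr.trans_lt hfar⟩
  obtain ⟨hi₀, hfar₀⟩ := Nat.find_spec hex
  have hi₀i : Nat.find hex ≤ i := Nat.find_min' hex ⟨hi, hPr.trans_lt hfar⟩
  have hclose : ∀ (k : ℕ) (hk : k < l.length), k < Nat.find hex →
      dist ((δ : ℂ) * hexCenter (l[k]'hk)) ((δ : ℂ) * hexCenter c) ≤ P := by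
    intro k hk hki
    by_contra hlt
    exact Nat.find_min hex hki ⟨hk, not_le.1 hlt⟩
  have h1 := stub_bandSuccess_decided Ω δ ρ P ρout S c l (Nat.find hex) hi₀ hS hρ hclose hfar₀
  have hlen : (l.take (i + 1)).length = i + 1 := by
    rw [List.length_take]
    omega
  have hi₀' : Nat.find hex < (l.take (i + 1)).length := by
    rw [hlen]
    omega
  have h2 := stub_bandSuccess_decided Ω δ ρ P ρout S c (l.take (i + 1)) (Nat.find hex) hi₀' hS hρ
    (fun k hk hki => by
      rw [List.getElem_take]
      exact hclose k (by rw [hlen] at hk; omega) hki)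
    (by rw [List.getElem_take]; exact hfar₀)
  rw [h1, h2, List.take_take, min_eq_left (by omega)]

/-! ### Lattice steps -/

/-- **One step of the rescaled domain graph has length `δ/√3 ≤ δ`** (`0 ≤ δ`). [folklore] -/
theorem dist_le_of_hexDomainGraph_adj {Ω : Set ℂ} {δ : ℝ} (hδ : 0 ≤ δ) {x y : HexVertex}
    (h : (hexDomainGraph Ω δ).Adj x y) :
    dist ((δ : ℂ) * hexCenter y) ((δ : ℂ) * hexCenter x) ≤ δ := by
  have h' : hexGraph.Adj x y := embDomainGraph_le hexGraph hexCenter Ω δ h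
  rw [dist_eq_norm, ← mul_sub, norm_mul, Complex.norm_real, Real.norm_eq_abs, abs_of_nonneg hδ,
    norm_hexCenter_sub_of_adj h']
  exact mul_le_of_le_one_right hδ (inv_le_one_of_one_le₀ (Real.one_le_sqrt.2 (by norm_num)))

/-- **The tip of an exit prefix is within one lattice step of the ball it leaves.**  For a
self-avoiding walk `ω₀ : u → t` of `Ω_δ` (`0 ≤ δ`) all of whose vertices other than the tip `t` are
within `r` of `z`, and whose root is within `r` of `z`, the tip is within `r + δ` of `z` (it is the
root, or adjacent to its predecessor, a non-tip vertex). [folklore] -/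
theorem dist_tip_le_of_isPath {Ω : Set ℂ} {δ r : ℝ} {u t : HexVertex} {z : ℂ} (hδ : 0 ≤ δ)
    (ω₀ : (hexDomainGraph Ω δ).Walk u t) (hπ : ω₀.IsPath)
    (hS : ∀ v ∈ ω₀.support, v ≠ t → dist ((δ : ℂ) * hexCenter v) z ≤ r)
    (hu : dist ((δ : ℂ) * hexCenter u) z ≤ r) :
    dist ((δ : ℂ) * hexCenter t) z ≤ r + δ := by
  rcases Nat.eq_zero_or_pos ω₀.length with h0 | hpos
  · have hut : u = t := SimpleGraph.Walk.eq_of_length_eq_zero h0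
    subst hut
    linarith
  · have hadj : (hexDomainGraph Ω δ).Adj (ω₀.getVert (ω₀.length - 1)) t := by
      have h := ω₀.adj_getVert_succ (i := ω₀.length - 1) (by omega)
      rwa [Nat.sub_add_cancel hpos, SimpleGraph.Walk.getVert_length] at h
    have hne : ω₀.getVert (ω₀.length - 1) ≠ t := fun h => by
      have := (hπ.getVert_eq_end_iff (Nat.sub_le _ _)).1 h
      omega
    have hp := hS _ (ω₀.getVert_mem_support _) hne
    have hstep := dist_le_of_hexDomainGraph_adj hδ hadj
    linarith [dist_triangle ((δ : ℂ) * hexCenter t)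
      ((δ : ℂ) * hexCenter (ω₀.getVert (ω₀.length - 1))) z]

end Summit.CriticalPhenomena.SAWScalingLimit.Theorems.ObservableToSLE.TypeLadder

end
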